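import Literature.GroupTheory.SpecificGroups.PGL2DicksonCharP
import HarnessLib

/-!
# Finite subgroups of `PGL₂(k)` in characteristic `p`, VII: the image of `SL₂(𝔽_q)` and
Dickson's theorem for large subgroups of `SL₂(𝔽_q)` (`p ≥ 5`)

Topic `GroupTheory/SpecificGroups`; theorems plus one small definition (`slToPGL F`, the map
`SL₂(F) → PGL₂(k)` for a subfield `F ≤ k`), no named facts.  Seventh part of the series
`PGL2SylowCharP` (I) … `PGL2DicksonCharP` (VI) formalising Dickson's classification of the finite
subgroups of `PGL₂(k)` after X. Faber, *Finite `p`-irregular subgroups of `PGL₂(k)`*,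
arXiv:1112.1999 = La Matematica 2 (2023) [Faber2011] and L. E. Dickson, *Linear groups* (1901),
Ch. XII [Dickson1901].  This part descends the classification over `k = 𝔽̄_q` (part VI,
`exists_smul_eq_or_exists_conj_eq_of_five_le`, `p ≥ 5`; Serre's Prop. 16 for the `p`-regular
side, `Serre1972.prop16_of_isAlgClosed`) to subgroups of the finite group `SL₂(𝔽_q)` through
`SL₂(𝔽_q) → PSL₂(𝔽_q) ≤ PGL₂(𝔽̄_q)`, in the form used in arithmetic combinatorics: **a proper
subgroup of `SL₂(𝔽_q)` of order `≥ β q²` (`q ≥ q₀(β)`) is contained in a Borel subgroup**, i.e.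
has a common eigenvector in `𝔽_q²` (Dickson 1901, Ch. XII, §260; Faber 2011, Thm. D: the
subgroups of `PGL₂(𝔽_q)` are cyclic or dihedral of order dividing `2(q ∓ 1)`, `𝔄₄`, `𝔖₄`, `𝔄₅`,
`PSL₂`/`PGL₂(𝔽_{p^s})` with `s ∣ r`, or `p`-semi-elementary = fixing a point).

## Contents (all proved)

* `mk_pow_eq_one_or_of_forall_mem`, `pow_eq_one_or_of_mem_pglTwo` — **element orders in
  `PGL₂(𝔽_q)`**: `x^{q-1} = 1 ∨ x^{q+1} = 1 ∨ x^p = 1` (split torus / non-split torus /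
  unipotent, by Cayley–Hamilton and the Frobenius `λ ↦ λ^q` on the eigenvalues;
  `sub_smul_pow_eq_of_mul_eq_zero` is the spectral formula `(λ-μ)gⁿ = λⁿ(g-μ) - μⁿ(g-λ)`);
  `orderOf_le_card_add_one_of_mem_pglTwo`.
* `card_le_or_of_le_pglTwo_of_not_dvd` — **a `p`-regular `K ≤ PGL₂(𝔽_q)` has `|K| ≤ 2(q+1)` or
  `|K| ≤ 60`** (Serre's list: cyclic, dihedral, `𝔄₄`, `𝔖₄`, `𝔄₅`).
* `slToPGL F : SL(2, F) →* PGL(Fin 2, k)` (range `pslTwo F`, kernel the centre `{±1}`,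
  `ker_slToPGL`, `card_ker_slToPGL_le_two`), `card_le_two_mul_card_map` (`|L| ≤ 2|image|`),
  **`eq_top_of_map_slToPGL_eq`** (full image ⇒ `L = SL₂(F)` for `|F| > 3`, via Mathlib's
  perfectness `Matrix.SL2.commutator_eq_top`), `card_pslTwo_le`, `card_pslTwo_dvd`,
  `pslTwo_eq_pglTwo_of_two` / `card_pslTwo_of_two` (`p = 2`), `card_pslTwo_eq_of_card_eq`.
* **`exists_mulVec_eq_smul_of_forall_smul_eq`** — if the image of `L ≤ SL₂(F)` is
  `p`-irregular and fixes a point of `ℙ¹(k)`, that point is `F`-rational: `L` has a common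
  eigenvector in `F²` (an element of order `p` is `±(1 + N)` with `N ≠ 0`, `N² = 0` rational;
  `mul_self_eq_trace_smul_sub_det_smul` is Cayley–Hamilton for `2 × 2` matrices).
* `pow_eq_pow_or_sq_le_of_mul_dvd` (`pᵃ(p²ᵃ-1) ∣ pⁿ(p²ⁿ-1)` ⇒ `a = n` or `2a ≤ n`) and
  **`eq_or_card_sq_le_of_conj_eq`**: an `H ≤ PSL₂(𝔽_Q)` conjugate to `PSL₂(𝔽_q)` or `PGL₂(𝔽_q)`
  is all of `PSL₂(𝔽_Q)` or has `|H|² ≤ Q³`.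
* **`PGL2.card_le_or_of_forall_exists_ne_smul_of_five_le`** (embedded `F ≤ k = k̄`) and
  **`SL2Dickson.card_le_or_of_forall_exists_ne_smul_of_five_le`** (abstract finite field `F`,
  through `F ≅ 𝔽_q ≤ 𝔽̄_q`, `AlgebraicClosure F`): for `p ≥ 5`, a proper `L < SL₂(F)` with no
  common eigenvector has `|L| ≤ 4(q+1) ∨ |L| ≤ 120 ∨ |L|² ≤ 4q³`;
  **`SL2Dickson.exists_forall_exists_eigenvector_of_five_le`**: for `β > 0` there is `Q₀`
  (namely `⌈8/β⌉ + ⌈120/β⌉ + ⌈4/β²⌉ + 1`) such that for `|F| ≥ Q₀`, `char F ≥ 5`, every proper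
  `L < SL₂(F)` with `|L| ≥ β|F|²` has a common eigenvector `v ∈ F² ∖ 0`.

## What is NOT here

Characteristics `2` and `3`: part VI assembles Faber's Theorem B only for `p ≥ 5` (for `p = 3`
the cases `PSL₂(𝔽_3)` and `𝔄₅`, for `p = 2` §6.1.2–6.1.3 are missing); the corresponding order
bounds and the characteristic-free form of the large-subgroup theorem are the sequel
`PGL2DicksonSmallCharP` / `SL2LargeSubgroupsFixLine`.  Also not here: the exact list of
subgroups of `SL₂(𝔽_q)` up to conjugacy (Faber's Thm. D), only the order/fixed-line trichotomy.

## References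

* [Faber2011] X. Faber, *Finite p-irregular subgroups of PGL₂(k)*, arXiv:1112.1999 (2011); La
  Matematica 2 (2023) 479–522 — Thm. B, Thm. C, Thm. D, Remark 2.1 (read 2026-08-22,
  `lit read arxiv:1112.1999`, pp. 5–6, 16–18).
* [Dickson1901] L. E. Dickson, *Linear groups with an exposition of the Galois field theory*,
  Teubner (1901), Ch. XII, §260 (the subgroups of `PSL₂(p^r)`; B. Huppert, *Endliche Gruppen I*,
  Hauptsatz II.8.27; M. Suzuki, *Group Theory I*, Thm. 3.6.25).
* [Serre1972] J.-P. Serre, *Propriétés galoisiennes des points d'ordre fini des courbes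
  elliptiques*, Invent. Math. 15 (1972), §2.5 Prop. 16 (tree: `Serre1972.prop16_of_isAlgClosed`).
-/

open scoped MatrixGroups OnePoint Pointwise
open Matrix MulAction

namespace Literature.GroupTheory.SpecificGroups.PGL2

open Literature.NumberTheory.GaloisRepresentations

variable {k : Type*} [Field k]

local notation "M₂" => Matrix (Fin 2) (Fin 2) k

/-! ### Element orders in `PGL₂(𝔽_q)`: `q - 1`, `q + 1` or `p` -/

section ElementOrders

/-- If `(g - λ)(g - μ) = 0` for a `2 × 2` matrix `g`, then `g (g - μ) = λ (g - μ)`. [folklore] -/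
private theorem mul_sub_eq_smul_sub_of_mul_eq_zero {g : M₂} {l m : k}
    (h : (g - l • (1 : M₂)) * (g - m • (1 : M₂)) = 0) :
    g * (g - m • (1 : M₂)) = l • (g - m • (1 : M₂)) := by
  have : (g - l • (1 : M₂)) * (g - m • (1 : M₂)) = g * (g - m • 1) - l • (g - m • 1) := by
    rw [sub_mul, smul_mul_assoc, one_mul]
  rw [this] at h
  exact (sub_eq_zero.mp h)

/-- … and hence `gⁿ (g - μ) = λⁿ (g - μ)` for every `n`. [folklore] -/
private theorem pow_mul_sub_eq_smul_sub_of_mul_eq_zero {g : M₂} {l m : k}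
    (h : (g - l • (1 : M₂)) * (g - m • (1 : M₂)) = 0) (n : ℕ) :
    g ^ n * (g - m • (1 : M₂)) = l ^ n • (g - m • (1 : M₂)) := by
  induction n with
  | zero => simp
  | succ n ih =>
    rw [pow_succ, mul_assoc, mul_sub_eq_smul_sub_of_mul_eq_zero h, mul_smul_comm, ih, smul_smul,
      pow_succ, mul_comm]

/-- **Spectral formula for powers.** If `(g - λ)(g - μ) = 0` then
`(λ - μ) gⁿ = λⁿ (g - μ) - μⁿ (g - λ)`. [folklore] -/
private theorem sub_smul_pow_eq_of_mul_eq_zero {g : M₂} {l m : k}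
    (h : (g - l • (1 : M₂)) * (g - m • (1 : M₂)) = 0) (n : ℕ) :
    (l - m) • g ^ n = l ^ n • (g - m • (1 : M₂)) - m ^ n • (g - l • (1 : M₂)) := by
  -- the two factors are polynomials in `g`, hence commute
  have hc : Commute (g - l • (1 : M₂)) (g - m • (1 : M₂)) :=
    ((Commute.refl g).sub_right ((Commute.one_right g).smul_right m)).sub_left
      (((Commute.one_left g).sub_right ((Commute.refl (1 : M₂)).smul_right m)).smul_left l)
  have h' : (g - m • (1 : M₂)) * (g - l • (1 : M₂)) = 0 := by rw [← hc.eq]; exact h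
  calc (l - m) • g ^ n = g ^ n * ((g - m • (1 : M₂)) - (g - l • (1 : M₂))) := by
        rw [sub_sub_sub_cancel_left, ← sub_smul, mul_smul_comm, mul_one]
    _ = g ^ n * (g - m • (1 : M₂)) - g ^ n * (g - l • (1 : M₂)) := mul_sub _ _ _
    _ = l ^ n • (g - m • (1 : M₂)) - m ^ n • (g - l • (1 : M₂)) := by
        rw [pow_mul_sub_eq_smul_sub_of_mul_eq_zero h n, pow_mul_sub_eq_smul_sub_of_mul_eq_zero h' n]

variable (p : ℕ) [Fact p.Prime] [CharP k p]

/-- A class `[g]` whose lift satisfies `gⁿ = c • 1` has `[g]ⁿ = 1`. [folklore] -/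
private theorem mk_pow_eq_one_of_pow_eq_smul_one {g : GL (Fin 2) k} {n : ℕ} {c : k}
    (h : ((g : M₂)) ^ n = c • (1 : M₂)) : Matrix.ProjGenLinGroup.mk g ^ n = 1 := by
  rw [← map_pow, Matrix.ProjGenLinGroup.mk_eq_one, GL2.mem_center_iff]
  have : ((g ^ n : GL (Fin 2) k) : M₂) = c • (1 : M₂) := by rw [Units.val_pow_eq_pow_val, h]
  simp [this]

/-- **Element orders in `PGL₂(𝔽_q)`.** Let `F ≤ k` be a finite subfield with `q` elements of the
algebraically closed field `k` of characteristic `p`, and `g ∈ GL₂(k)` a matrix with entries in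
`F`.  Then `[g]^{q-1} = 1`, or `[g]^{q+1} = 1`, or `[g]^p = 1` in `PGL₂(k)` — according as the
characteristic polynomial of `g` has two distinct roots in `𝔽_q` (split torus), two conjugate
roots in `𝔽_{q²} ∖ 𝔽_q` (non-split torus, `λ^q = μ`, `λ^{q+1} = det g`), or a double root
(`g` = scalar · unipotent).  (Dickson 1901, Ch. XII; the orders of the elements of `PSL₂(𝔽_q)`
divide `(q ∓ 1)/2` or equal `p`.) [cite: Dickson1901, §240] -/
theorem mk_pow_eq_one_or_of_forall_mem [IsAlgClosed k] (F : Subfield k) [Finite F]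
    {g : GL (Fin 2) k} (hg : ∀ i j, g i j ∈ F) :
    Matrix.ProjGenLinGroup.mk g ^ (Nat.card F - 1) = 1 ∨
      Matrix.ProjGenLinGroup.mk g ^ (Nat.card F + 1) = 1 ∨ Matrix.ProjGenLinGroup.mk g ^ p = 1 := by
  classical
  haveI : Fintype F := Fintype.ofFinite F
  have pp : p.Prime := Fact.out
  haveI : CharP F p := inferInstance
  obtain ⟨n, -, hQ⟩ := FiniteField.card F p
  rw [← Nat.card_eq_fintype_card] at hQ
  set Q := Nat.card F with hQdef
  -- Frobenius fixes `F`
  have frob : ∀ x ∈ F, x ^ Q = x := fun x hx => by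
    have := FiniteField.pow_card (⟨x, hx⟩ : F)
    rw [← Nat.card_eq_fintype_card] at this
    exact congrArg Subtype.val this
  set t := (g : M₂).trace with htdef
  set d := (g : M₂).det with hddef
  have htF : t ∈ F := by rw [htdef, Matrix.trace_fin_two]; exact F.add_mem (hg 0 0) (hg 1 1)
  have hdF : d ∈ F := by
    rw [hddef, Matrix.det_fin_two]
    exact F.sub_mem (F.mul_mem (hg 0 0) (hg 1 1)) (F.mul_mem (hg 0 1) (hg 1 0))
  have hd0 : d ≠ 0 := GL2.det_ne_zero g
  -- the eigenvalues `l`, `m = t - l`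
  obtain ⟨l, hl⟩ := Serre1972.exists_root_quadratic t d
  set m := t - l with hmdef
  have hlm : l * m = d := by rw [hmdef]; linear_combination -hl
  have htlm : l + m = t := by rw [hmdef]; ring
  -- Cayley–Hamilton: `(g - l)(g - m) = 0`
  have hCH : ((g : M₂) - l • (1 : M₂)) * ((g : M₂) - m • (1 : M₂)) = 0 := by
    have h0 := Matrix.aeval_self_charpoly (g : M₂)
    rw [Matrix.charpoly_fin_two, map_add, map_sub, map_mul, map_pow, Polynomial.aeval_X,
      Polynomial.aeval_C, Polynomial.aeval_C, Algebra.algebraMap_eq_smul_one,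
      Algebra.algebraMap_eq_smul_one, ← htdef, ← hddef] at h0
    calc ((g : M₂) - l • (1 : M₂)) * ((g : M₂) - m • (1 : M₂))
        = (g : M₂) * (g : M₂) - (l + m) • (g : M₂) + (l * m) • (1 : M₂) := by
          simp only [sub_mul, mul_sub, smul_mul_assoc, mul_smul_comm, one_mul, mul_one, smul_smul,
            smul_sub, add_smul, mul_comm m l]
          abel
      _ = (g : M₂) ^ 2 - t • (1 : M₂) * (g : M₂) + d • (1 : M₂) := by
          rw [htlm, hlm, sq, smul_mul_assoc, one_mul]
      _ = 0 := h0
  -- any root of the characteristic polynomial is `l` or `m`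
  have hroot : ∀ r : k, r ^ 2 - t * r + d = 0 → r = l ∨ r = m := by
    intro r hr
    have : (r - l) * (r - m) = 0 := by rw [← htlm, ← hlm] at hr; linear_combination hr
    rcases mul_eq_zero.mp this with h | h
    · exact Or.inl (sub_eq_zero.mp h)
    · exact Or.inr (sub_eq_zero.mp h)
  -- Frobenius permutes the roots
  have hlQ : l ^ Q = l ∨ l ^ Q = m := by
    apply hroot
    have h1 : (l ^ 2 - t * l + d) ^ Q = 0 := by rw [hl, zero_pow]; rw [hQ]; exact pow_ne_zero _ pp.ne_zero
    rw [hQ, add_pow_char_pow, sub_pow_char_pow, mul_pow, ← pow_mul, ← hQ, frob t htF, frob d hdF,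
      mul_comm 2, pow_mul] at h1
    exact h1
  by_cases heq : l = m
  · -- double root: `g = l + N`, `N² = 0`, `g^p = l^p`
    right; right
    set N : M₂ := (g : M₂) - l • (1 : M₂) with hN
    have hNN : N * N = 0 := by rw [hN]; nth_rw 2 [heq]; exact hCH
    have hgN : (g : M₂) = l • (1 : M₂) + N := by rw [hN]; abel
    apply mk_pow_eq_one_of_pow_eq_smul_one (c := l ^ p)
    have hc : Commute (l • (1 : M₂)) N := ((Commute.one_left N).smul_left l)
    rw [hgN, add_pow_char_of_commute p hc, smul_pow, one_pow]
    have hNp : N ^ p = 0 := by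
      obtain ⟨r, hr⟩ : ∃ r, p = r + 2 := ⟨p - 2, by have := pp.two_le; omega⟩
      rw [hr, pow_add, sq, hNN, mul_zero]
    rw [hNp, add_zero]
  rcases hlQ with hlQ | hlQ
  · -- split torus: `l^q = l`, `m^q = m`, `g^{q-1} = 1`
    left
    have hl0 : l ≠ 0 := fun h0 => hd0 (by rw [← hlm, h0, zero_mul])
    have hm0 : m ≠ 0 := fun h0 => hd0 (by rw [← hlm, h0, mul_zero])
    have hQ1 : 1 ≤ Q := by rw [hQ]; exact Nat.one_le_pow _ _ pp.pos
    have hlQ1 : l ^ (Q - 1) = 1 := by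
      have : l ^ (Q - 1) * l = 1 * l := by rw [← pow_succ, Nat.sub_add_cancel hQ1, hlQ, one_mul]
      exact mul_right_cancel₀ hl0 this
    have hmQ : m ^ Q = m := by rw [hmdef, hQ, sub_pow_char_pow, ← hQ, frob t htF, hlQ]
    have hmQ1 : m ^ (Q - 1) = 1 := by
      have : m ^ (Q - 1) * m = 1 * m := by rw [← pow_succ, Nat.sub_add_cancel hQ1, hmQ, one_mul]
      exact mul_right_cancel₀ hm0 this
    have hsp := sub_smul_pow_eq_of_mul_eq_zero hCH (Q - 1)
    rw [hlQ1, hmQ1, one_smul, one_smul, sub_sub_sub_cancel_left, ← sub_smul] at hsp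
    have hgQ : (g : M₂) ^ (Q - 1) = (1 : k) • (1 : M₂) := by
      rw [one_smul]
      exact smul_right_injective M₂ (sub_ne_zero.mpr heq) hsp
    exact mk_pow_eq_one_of_pow_eq_smul_one hgQ
  · -- non-split torus: `l^q = m`, `m^q = l`, `g^{q+1} = d`
    right; left
    have hmQ : m ^ Q = l := by
      rw [hmdef, hQ, sub_pow_char_pow, ← hQ, frob t htF, hlQ, hmdef, sub_sub_cancel]
    have hlQ1 : l ^ (Q + 1) = d := by rw [pow_succ, hlQ, mul_comm, hlm]
    have hmQ1 : m ^ (Q + 1) = d := by rw [pow_succ, hmQ, hlm]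
    have hsp := sub_smul_pow_eq_of_mul_eq_zero hCH (Q + 1)
    rw [hlQ1, hmQ1, ← smul_sub, sub_sub_sub_cancel_left, ← sub_smul, smul_smul, mul_comm,
      ← smul_smul] at hsp
    exact mk_pow_eq_one_of_pow_eq_smul_one (smul_right_injective M₂ (sub_ne_zero.mpr heq) hsp)

/-- **Element orders in `PGL₂(𝔽_q)`**, subgroup form: every element of `PGL₂(F) ≤ PGL₂(k)`
(`pglTwo F`) satisfies `x^{q-1} = 1 ∨ x^{q+1} = 1 ∨ x^p = 1`. [cite: Dickson1901, §240] -/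
theorem pow_eq_one_or_of_mem_pglTwo [IsAlgClosed k] (F : Subfield k) [Finite F]
    {x : PGL(Fin 2, k)} (hx : x ∈ pglTwo F) :
    x ^ (Nat.card F - 1) = 1 ∨ x ^ (Nat.card F + 1) = 1 ∨ x ^ p = 1 := by
  obtain ⟨y, rfl⟩ := hx
  induction y using Matrix.ProjGenLinGroup.induction_on with
  | mk g' =>
    rw [Matrix.ProjGenLinGroup.map_mk]
    exact mk_pow_eq_one_or_of_forall_mem p F (g := Matrix.GeneralLinearGroup.map F.subtype g')
      (fun i j => by rw [Matrix.GeneralLinearGroup.map_apply]; exact (g' i j).2)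

/-- The order of a `p`-regular element of `PGL₂(𝔽_q)` divides `q - 1` or `q + 1`; in particular
it is at most `q + 1`. [cite: Dickson1901, §240] -/
theorem orderOf_le_card_add_one_of_mem_pglTwo [IsAlgClosed k] (F : Subfield k) [Finite F]
    {x : PGL(Fin 2, k)} (hx : x ∈ pglTwo F) (hreg : ¬ p ∣ orderOf x) :
    orderOf x ≤ Nat.card F + 1 := by
  have pp : p.Prime := Fact.out
  haveI : Fintype F := Fintype.ofFinite F
  have hQ1 : 1 < Nat.card F := by rw [Nat.card_eq_fintype_card]; exact Fintype.one_lt_card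
  rcases pow_eq_one_or_of_mem_pglTwo p F hx with h | h | h
  · exact (Nat.le_of_dvd (by omega) (orderOf_dvd_of_pow_eq_one h)).trans (by omega)
  · exact Nat.le_of_dvd (by omega) (orderOf_dvd_of_pow_eq_one h)
  · have hdvd := orderOf_dvd_of_pow_eq_one h
    rcases (Nat.dvd_prime pp).mp hdvd with h1 | h1
    · rw [h1]; omega
    · exact absurd (h1 ▸ dvd_rfl) hreg

/-! ### `p`-regular subgroups of `PGL₂(𝔽_q)` are small -/

/-- **A `p`-regular subgroup of `PGL₂(𝔽_q)` has order `≤ 2(q + 1)` or `≤ 60`.**  By Serre's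
Prop. 16 (`Serre1972.prop16_of_isAlgClosed`) a finite `K ≤ PGL₂(k)` of order prime to `p` is
cyclic, dihedral, or `𝔄₄`, `𝔖₄`, `𝔄₅`; inside `PGL₂(𝔽_q)` the cyclic ones have order dividing
`q ∓ 1` and the dihedral ones twice that (Dickson 1901, Ch. XII, §260; Faber 2011, Thm. D:
"If `q ≡ ± 1 (mod n)`, then `G` contains … cyclic subgroups of order `n` and dihedral subgroups of
order `2n`"). [cite: Faber2011, Thm. D] -/
theorem card_le_or_of_le_pglTwo_of_not_dvd [IsAlgClosed k] (F : Subfield k) [Finite F]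
    (K : Subgroup PGL(Fin 2, k)) [Finite K] (hK : K ≤ pglTwo F) (hreg : ¬ p ∣ Nat.card K) :
    Nat.card K ≤ 2 * (Nat.card F + 1) ∨ Nat.card K ≤ 60 := by
  have pp : p.Prime := Fact.out
  have hK0 : ((Nat.card K : ℕ) : k) ≠ 0 := by
    rw [Ne, CharP.cast_eq_zero_iff k p]
    exact hreg
  have hpos : 0 < Nat.card K := Nat.card_pos
  -- an element of `K` has `p`-regular order, hence order `≤ q + 1`
  have hord : ∀ y : K, orderOf y ≤ Nat.card F + 1 := by
    intro y
    rw [← Subgroup.orderOf_coe]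
    refine orderOf_le_card_add_one_of_mem_pglTwo p F (hK y.2) ?_
    rw [Subgroup.orderOf_coe]
    exact fun h => hreg (h.trans (orderOf_dvd_natCard y))
  rcases Serre1972.prop16_of_isAlgClosed K hK0 with hcyc | ⟨m, ⟨e⟩⟩ | he | he | he
  · left
    obtain ⟨x, hx⟩ := IsCyclic.exists_ofOrder_eq_natCard (α := K)
    have := hord x
    omega
  · left
    have hcard : Nat.card K = 2 * m := by rw [Nat.card_congr e.toEquiv, DihedralGroup.nat_card]
    have hy : orderOf (e.symm (DihedralGroup.r 1)) = m := by
      rw [MulEquiv.orderOf_eq, DihedralGroup.orderOf_r_one]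
    have := hord (e.symm (DihedralGroup.r 1))
    omega
  · right
    obtain ⟨e⟩ := he
    rw [Nat.card_congr e.toEquiv, nat_card_alternatingGroup, Nat.card_eq_fintype_card,
      Fintype.card_fin]
    decide
  · right
    obtain ⟨e⟩ := he
    rw [Nat.card_congr e.toEquiv, Nat.card_perm, Nat.card_eq_fintype_card, Fintype.card_fin]
    decide
  · right
    obtain ⟨e⟩ := he
    rw [Nat.card_congr e.toEquiv, nat_card_alternatingGroup, Nat.card_eq_fintype_card,
      Fintype.card_fin]
    decide

end ElementOrders

/-! ### The map `SL₂(F) → PGL₂(k)` for a subfield `F ≤ k` -/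

section SLMap

variable (F : Subfield k)

/-- **`SL₂(F) → PGL₂(k)`** for a subfield `F ≤ k`: `g ↦ [g]`; its range is `PSL₂(F) = pslTwo F`
and its kernel is `{±1}`. [cite: Dickson1901, §239] -/
def slToPGL (F : Subfield k) : SL(2, F) →* PGL(Fin 2, k) :=
  (Matrix.ProjGenLinGroup.map (n := Fin 2) F.subtype).comp
    (Matrix.SpecialLinearGroup.toPGL : SL(2, F) →* PGL(Fin 2, F))

/-- The range of `SL₂(F) → PGL₂(k)` is `pslTwo F`. [cite: Dickson1901, §239] -/
theorem range_slToPGL : (slToPGL F).range = pslTwo F := rfl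

/-- `slToPGL F g = [g]` with the lift `g` viewed in `GL₂(k)`. [folklore] -/
private theorem slToPGL_apply (g : SL(2, F)) :
    slToPGL F g = Matrix.ProjGenLinGroup.mk
      (Matrix.GeneralLinearGroup.map F.subtype (Matrix.SpecialLinearGroup.toGL g)) := by
  rw [slToPGL, MonoidHom.comp_apply, Matrix.SpecialLinearGroup.toPGL, MonoidHom.comp_apply,
    Matrix.ProjGenLinGroup.map_mk]

/-- The entries of the lift are the entries of `g`. [folklore] -/
@[simp] private theorem map_toGL_apply (g : SL(2, F)) (i j : Fin 2) :
    (Matrix.GeneralLinearGroup.map F.subtype (Matrix.SpecialLinearGroup.toGL g)) i j =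
      ((g : Matrix (Fin 2) (Fin 2) F) i j : k) := by
  rw [Matrix.GeneralLinearGroup.map_apply]
  rfl

/-- The image of an element of `SL₂(F)` lies in `PGL₂(F)`. [folklore] -/
private theorem slToPGL_mem_pglTwo (g : SL(2, F)) : slToPGL F g ∈ pglTwo F :=
  pslTwo_le_pglTwo F ⟨g, rfl⟩

/-- The kernel of `SL₂(F) → PGL₂(k)` is the centre `{±1}` of `SL₂(F)`. [cite: Dickson1901, §239] -/
theorem ker_slToPGL : (slToPGL F).ker = Subgroup.center SL(2, F) := by
  rw [slToPGL, ← MonoidHom.comap_ker, (MonoidHom.ker_eq_bot_iff _).mpr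
    (Serre1972.projGenLinGroup_map_injective F.subtype), MonoidHom.comap_bot,
    Matrix.SpecialLinearGroup.toPGL_ker]

/-- The kernel of `SL₂(F) → PGL₂(k)` has at most two elements. [cite: Dickson1901, §239] -/
theorem card_ker_slToPGL_le_two : Nat.card (slToPGL F).ker ≤ 2 := by
  rw [ker_slToPGL, Nat.card_congr (Matrix.SpecialLinearGroup.center_equiv_rootsOfUnity' (0 : Fin 2)
    (R := F)).toEquiv, Fintype.card_fin]
  exact card_rootsOfUnity F 2

/-- **`|L| ≤ 2 · |image of L|`** for a subgroup `L ≤ SL₂(F)`. [cite: Dickson1901, §239] -/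
theorem card_le_two_mul_card_map (L : Subgroup SL(2, F)) [Finite L] :
    Nat.card L ≤ 2 * Nat.card (L.map (slToPGL F)) := by
  set ψ := (slToPGL F).restrict L with hψ
  have h1 : Nat.card L = Nat.card (L.map (slToPGL F)) * Nat.card ψ.ker := by
    rw [← MonoidHom.restrict_range, Subgroup.card_eq_card_quotient_mul_card_subgroup ψ.ker,
      Nat.card_congr (QuotientGroup.quotientKerEquivRange ψ).toEquiv]
  have h2 : Nat.card ψ.ker ≤ 2 := by
    rw [hψ, MonoidHom.ker_restrict]
    haveI : Finite (slToPGL F).ker := by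
      rw [ker_slToPGL]
      exact Finite.of_injective _ (Matrix.SpecialLinearGroup.center_equiv_rootsOfUnity'
        (0 : Fin 2) (R := F)).injective
    refine (Nat.card_le_card_of_injective
      (fun x : (slToPGL F).ker.subgroupOf L => (⟨(x : L), x.2⟩ : (slToPGL F).ker)) ?_).trans
      (card_ker_slToPGL_le_two F)
    intro x y hxy
    exact Subtype.ext (Subtype.ext (congrArg (fun z : (slToPGL F).ker => ((z : SL(2, F)))) hxy))
  rw [h1, mul_comm]
  exact Nat.mul_le_mul_right _ h2

/-- **A subgroup of `SL₂(F)` with full image in `PSL₂(F)` is everything** (`|F| > 3`): its image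
being everything means `L · {±1} = SL₂(F)`, so `L` is normal with abelian quotient and contains
the commutator subgroup, which is all of `SL₂(F)` as soon as `F` has an element `a` with
`a ≠ 0`, `a² ≠ 1` (Mathlib `Matrix.SL2.commutator_eq_top`). [cite: Dickson1901, §239] -/
theorem eq_top_of_map_slToPGL_eq [Finite F] (hF : 3 < Nat.card F) {L : Subgroup SL(2, F)}
    (hL : L.map (slToPGL F) = pslTwo F) : L = ⊤ := by
  -- `L ⊔ centre = ⊤`
  have hsup : L ⊔ Subgroup.center SL(2, F) = ⊤ := by
    have h1 := Subgroup.comap_map_eq (slToPGL F) L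
    have h2 := Subgroup.comap_map_eq (slToPGL F) ⊤
    rw [hL] at h1
    rw [← MonoidHom.range_eq_map, range_slToPGL, h1, ker_slToPGL, top_sup_eq] at h2
    exact h2
  -- every element is `l z` with `l ∈ L`, `z` central; commutators lie in `L`
  have hdec : ∀ g : SL(2, F), ∃ l ∈ L, ∃ z ∈ Subgroup.center SL(2, F), l * z = g := by
    intro g
    have hg : g ∈ ((L ⊔ Subgroup.center SL(2, F) : Subgroup SL(2, F)) : Set SL(2, F)) := by
      rw [hsup]; exact Subgroup.mem_top g
    rw [Subgroup.mul_normal] at hg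
    exact Set.mem_mul.mp hg
  -- conjugating by `a z`, `z` central, is conjugating by `a`
  have hconj : ∀ a z X : SL(2, F), z ∈ Subgroup.center SL(2, F) →
      a * z * X * (a * z)⁻¹ = a * X * a⁻¹ := by
    intro a z X hz
    have hzc := Subgroup.mem_center_iff.mp hz
    rw [_root_.mul_inv_rev, mul_assoc a z X, ← hzc X]
    simp only [mul_assoc, mul_inv_cancel_left]
  have hcomm : commutator SL(2, F) ≤ L := by
    rw [commutator_def, Subgroup.commutator_le]
    intro a _ b _
    obtain ⟨l₁, hl₁, z₁, hz₁, rfl⟩ := hdec a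
    obtain ⟨l₂, hl₂, z₂, hz₂, rfl⟩ := hdec b
    have hz₂c := Subgroup.mem_center_iff.mp hz₂
    have hzl : ∀ x y : SL(2, F), z₂ * (x * y) = x * (z₂ * y) := fun x y => by
      rw [← mul_assoc, ← hz₂c x, mul_assoc]
    rw [commutatorElement_def, hconj l₁ z₁ (l₂ * z₂) hz₁, _root_.mul_inv_rev]
    simp only [mul_assoc]
    rw [hzl, mul_inv_cancel_left]
    exact L.mul_mem hl₁ (L.mul_mem hl₂ (L.mul_mem (L.inv_mem hl₁) (L.inv_mem hl₂)))
  -- the commutator subgroup is everything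
  obtain ⟨η, hη, hη0, hη1⟩ := exists_mem_ne_zero_sq_ne_one F hF
  have ha : (⟨η, hη⟩ : F) ≠ 0 := fun h => hη0 (congrArg Subtype.val h)
  have ha2 : (⟨η, hη⟩ : F) ^ 2 ≠ 1 := fun h => hη1 (by simpa using congrArg Subtype.val h)
  rw [Matrix.SL2.commutator_eq_top ha ha2] at hcomm
  exact top_le_iff.mp hcomm

/-- `|PSL₂(F)| ≤ q(q² - 1)` (indeed `= q(q²-1)/gcd(2, q-1)`). [cite: Dickson1901, §239] -/
theorem card_pslTwo_le [Finite F] : Nat.card (pslTwo F) ≤ Nat.card F * (Nat.card F ^ 2 - 1) := by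
  haveI : Fintype F := Fintype.ofFinite F
  have hq : 1 < Nat.card F := by rw [Nat.card_eq_fintype_card]; exact Fintype.one_lt_card
  haveI : Finite (pglTwo F) := by
    apply Nat.finite_of_card_ne_zero
    rw [card_pglTwo]
    exact Nat.mul_ne_zero (by omega) (Nat.sub_ne_zero_of_lt (Nat.one_lt_pow two_ne_zero hq))
  rw [← card_pglTwo]
  exact Subgroup.card_le_of_le (pslTwo_le_pglTwo F)

/-- `|PSL₂(F)|` divides `q(q² - 1) = |PGL₂(F)|`. [cite: Dickson1901, §239] -/
theorem card_pslTwo_dvd [Finite F] : Nat.card (pslTwo F) ∣ Nat.card F * (Nat.card F ^ 2 - 1) := by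
  haveI : Fintype F := Fintype.ofFinite F
  rw [← card_pglTwo]
  exact Subgroup.card_dvd_of_le (pslTwo_le_pglTwo F)

end SLMap

/-! ### A common fixed point of a `p`-irregular image is a rational eigenline -/

section RationalLine

variable {R : Type*} [CommRing R]

omit [Field k] in
/-- **Cayley–Hamilton for `2 × 2` matrices**: `A² = tr(A) A - det(A)`. [folklore] -/
private theorem mul_self_eq_trace_smul_sub_det_smul (A : Matrix (Fin 2) (Fin 2) R) :
    A * A = A.trace • A - A.det • (1 : Matrix (Fin 2) (Fin 2) R) := by
  ext i j
  rw [Matrix.trace_fin_two, Matrix.det_fin_two]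
  fin_cases i <;> fin_cases j <;> simp [Matrix.mul_apply, Fin.sum_univ_two] <;> ring

omit [Field k] in
/-- If `det A = 1` and `tr A = 2s` with `s² = 1`, then `N = sA - 1` has `N² = 0`
(`A = s(1 + N)` is `±` a unipotent). [folklore] -/
private theorem smul_sub_one_mul_self_eq_zero {A : Matrix (Fin 2) (Fin 2) R} (hdet : A.det = 1) {s : R}
    (hs : s * s = 1) (ht : A.trace = 2 * s) :
    (s • A - 1) * (s • A - 1) = 0 := by
  have hAA : A * A = s • A + s • A - 1 := by
    rw [mul_self_eq_trace_smul_sub_det_smul, hdet, ht, one_smul, two_mul, add_smul]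
  have h1 : (s • A - 1) * (s • A - 1) = (s * s) • (A * A) - s • A - s • A + 1 := by
    simp only [sub_mul, mul_sub, smul_mul_assoc, mul_smul_comm, mul_one, one_mul, smul_sub,
      smul_smul]
    abel
  rw [h1, hs, one_smul, hAA]
  abel

variable [DecidableEq k] (p : ℕ) [Fact p.Prime] [CharP k p]

/-- **A common fixed point of a `p`-irregular image is an `F`-rational eigenline.**  Let
`L ≤ SL₂(F)` (`F ≤ k` a subfield, `k` algebraically closed of characteristic `p`) whose image
`H ≤ PGL₂(k)` has order divisible by `p` and fixes a point `x ∈ ℙ¹(k)`.  Then `L` has a common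
eigenvector `v ∈ F² ∖ 0`: an element of order `p` of `H` is the class of `±(1 + N)` with
`N ≠ 0`, `N² = 0` rational, whose unique fixed point `ker N` is therefore `F`-rational and equals
`x` (Dickson's case "`G ⊂ B(k)`", Faber 2011, Lemma 6.3 (1) / Cor. 4.10, read over `𝔽_q`).
[cite: Faber2011, Remark 2.1] -/
theorem exists_mulVec_eq_smul_of_forall_smul_eq [IsAlgClosed k] (F : Subfield k)
    (L : Subgroup SL(2, F)) [Finite (L.map (slToPGL F))]
    (hdvd : p ∣ Nat.card (L.map (slToPGL F))) {x : OnePoint k}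
    (hx : ∀ h ∈ L.map (slToPGL F), h • x = x) :
    ∃ v : Fin 2 → F, v ≠ 0 ∧ ∀ g ∈ L, ∃ a : F, (g : Matrix (Fin 2) (Fin 2) F) *ᵥ v = a • v := by
  have pp : p.Prime := Fact.out
  -- an element of order `p` in the image: the class of a rational `g₀ ∈ L`
  obtain ⟨u, hu⟩ := exists_prime_orderOf_dvd_card' p hdvd
  obtain ⟨g₀, hg₀L, hg₀u⟩ := Subgroup.mem_map.mp u.2
  set A : Matrix (Fin 2) (Fin 2) F := (g₀ : Matrix (Fin 2) (Fin 2) F) with hA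
  set ĝ : GL (Fin 2) k := Matrix.GeneralLinearGroup.map F.subtype
    (Matrix.SpecialLinearGroup.toGL g₀) with hĝ
  have hĝA : (ĝ : M₂) = A.map F.subtype := by
    ext i j
    rw [hĝ, map_toGL_apply, Matrix.map_apply]
    rfl
  have hmkĝ : Matrix.ProjGenLinGroup.mk ĝ = (u : PGL(Fin 2, k)) := by rw [← hg₀u, slToPGL_apply]
  have hup : Matrix.ProjGenLinGroup.mk ĝ ^ p = 1 := by
    rw [hmkĝ, ← Subgroup.coe_pow, ← hu, pow_orderOf_eq_one, Subgroup.coe_one]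
  have hu1 : Matrix.ProjGenLinGroup.mk ĝ ≠ 1 := by
    intro h1
    rw [hmkĝ, ← Subgroup.coe_one, Subtype.coe_inj] at h1
    rw [h1, orderOf_one] at hu
    exact pp.one_lt.ne' hu.symm
  -- trace criterion: `tr(A)² = 4`, `det A = 1`
  have hdetA : A.det = 1 := g₀.prop
  have hdetĝ : (ĝ : M₂).det = 1 := by
    rw [hĝA, ← RingHom.mapMatrix_apply, ← RingHom.map_det, hdetA, map_one]
  have htrĝ : (ĝ : M₂).trace = (A.trace : k) := by
    rw [hĝA, Matrix.trace_fin_two, Matrix.trace_fin_two, Matrix.map_apply, Matrix.map_apply]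
    simp
  have htr2 : A.trace ^ 2 = 4 := by
    have h := (mk_pow_char_eq_one_iff_trace_sq p ĝ).mp hup
    rw [hdetĝ, mul_one, htrĝ] at h
    apply F.subtype.injective
    rw [map_pow, map_ofNat]
    exact h
  -- the sign `s = ±1` with `tr A = 2s`
  obtain ⟨s, hs, hts⟩ : ∃ s : F, s * s = 1 ∧ A.trace = 2 * s := by
    have : (A.trace - 2) * (A.trace + 2) = 0 := by linear_combination htr2
    rcases mul_eq_zero.mp this with h | h
    · exact ⟨1, one_mul 1, by linear_combination h⟩
    · exact ⟨-1, by ring, by linear_combination h⟩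
  -- the rational nilpotent `N = sA - 1 ≠ 0`, `N² = 0`, and its kernel vector `v`
  set N : Matrix (Fin 2) (Fin 2) F := s • A - 1 with hN
  have hNN : N * N = 0 := smul_sub_one_mul_self_eq_zero hdetA hs hts
  have hs0 : (s : k) ≠ 0 := by
    intro h0
    have : s = 0 := F.subtype.injective (by simpa using h0)
    rw [this, mul_zero] at hs
    exact zero_ne_one hs
  have hN0 : N ≠ 0 := by
    intro h0
    apply hu1
    rw [Matrix.ProjGenLinGroup.mk_eq_one, GL2.mem_center_iff, hĝA]
    have hA1 : A = (s : F) • (1 : Matrix (Fin 2) (Fin 2) F) := by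
      have : s • A = 1 := sub_eq_zero.mp (by rw [← hN]; exact h0)
      calc A = (s * s) • A := by rw [hs, one_smul]
        _ = s • (1 : Matrix (Fin 2) (Fin 2) F) := by rw [← smul_smul, this]
    simp [Matrix.map_apply, hA1, Matrix.smul_apply]
  obtain ⟨v, hv0, hNv⟩ := Serre1972.exists_ne_zero_mulVec_eq_zero hN0 hNN
  refine ⟨v, hv0, ?_⟩
  -- its image `v̂ ∈ k²` spans the unique fixed point of `[ĝ]`, which is therefore `x`
  set w : Fin 2 → k := F.subtype ∘ v with hw
  have hw0 : w ≠ 0 := by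
    intro h0
    apply hv0
    funext i
    exact F.subtype.injective (by simpa [hw] using congrFun h0 i)
  have hĝw : (ĝ : M₂) *ᵥ w = (s : k) • w := by
    -- `(sA - 1) v = 0` gives `A v = s v` (as `s² = 1`)
    have h1 : A *ᵥ v = s • v := by
      have h2 : (s • A) *ᵥ v = v := by
        have := hNv
        rwa [hN, Matrix.sub_mulVec, Matrix.one_mulVec, sub_eq_zero] at this
      calc A *ᵥ v = (s * s) • (A *ᵥ v) := by rw [hs, one_smul]
        _ = s • ((s • A) *ᵥ v) := by rw [← smul_smul, Matrix.smul_mulVec]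
        _ = s • v := by rw [h2]
    funext i
    have := RingHom.map_mulVec F.subtype A v i
    rw [h1] at this
    rw [hĝA, hw, ← this]
    simp
  set e := OnePoint.equivProjectivization k with he
  set xw : OnePoint k := e.symm (Projectivization.mk k w hw0) with hxw
  have hfixw : ĝ • xw = xw := by
    rw [hxw, he, smul_symm_mk_eq_iff ĝ hw0]
    exact ⟨s, hĝw⟩
  -- uniqueness of the fixed point of the unipotent class `[s ĝ] = [ĝ]`
  have hdet1 : ((s : k) • (ĝ : M₂)).det ≠ 0 := by
    rw [Matrix.det_smul, hdetĝ, mul_one, Fintype.card_fin]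
    exact pow_ne_zero _ hs0
  set g₁ : GL (Fin 2) k := Matrix.GeneralLinearGroup.mkOfDetNeZero _ hdet1 with hg₁
  have hg₁v : (g₁ : M₂) = (s : k) • (ĝ : M₂) := rfl
  have hmk₁ : Matrix.ProjGenLinGroup.mk g₁ = Matrix.ProjGenLinGroup.mk ĝ := by
    rw [GL2.mk_eq_mk_iff_smul]
    refine ⟨Units.mk0 (s : k) hs0, ?_⟩
    have hss : (s : k) * (s : k) = 1 := by
      have := congrArg Subtype.val hs
      simpa using this
    rw [hg₁v, Units.val_mk0, smul_smul, hss, one_smul]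
  have hkey : (g₁ : M₂) - 1 = N.map F.subtype := by
    rw [hg₁v, hĝA, hN]
    ext i j
    simp only [Matrix.sub_apply, Matrix.smul_apply, Matrix.map_apply, Matrix.one_apply, smul_eq_mul,
      map_sub, map_mul]
    split_ifs <;> simp
  have hN₁0 : (g₁ : M₂) - 1 ≠ 0 := by
    rw [hkey]
    intro h0
    apply hN0
    apply Matrix.map_injective F.subtype.injective
    change N.map F.subtype = (0 : Matrix (Fin 2) (Fin 2) F).map F.subtype
    rw [h0, Matrix.map_zero _ (map_zero F.subtype)]
  have hN₁N : ((g₁ : M₂) - 1) * ((g₁ : M₂) - 1) = 0 := by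
    rw [hkey, ← RingHom.mapMatrix_apply, ← map_mul, hNN, map_zero]
  obtain ⟨x₁, -, huniq⟩ := existsUnique_smul_eq_of_sub_one_mul_self_eq_zero hN₁0 hN₁N
  have hfix_iff : ∀ y : OnePoint k, g₁ • y = y ↔ Matrix.ProjGenLinGroup.mk ĝ • y = y := by
    intro y; rw [← mk_smul, hmk₁]
  have hxw_eq : x = xw := by
    have h1 : g₁ • x = x := (hfix_iff x).mpr (hx _ (by rw [hmkĝ]; exact u.2))
    have h2 : g₁ • xw = xw := (hfix_iff xw).mpr (by rw [mk_smul]; exact hfixw)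
    rw [huniq x h1, huniq xw h2]
  -- every element of `L` fixes `x = [w]`, i.e. has `w` as an eigenvector, rationally
  intro g hg
  set ĥ : GL (Fin 2) k := Matrix.GeneralLinearGroup.map F.subtype
    (Matrix.SpecialLinearGroup.toGL g) with hĥ
  have hĥA : (ĥ : M₂) = (g : Matrix (Fin 2) (Fin 2) F).map F.subtype := by
    ext i j
    rw [hĥ, map_toGL_apply, Matrix.map_apply]
    rfl
  have hfix : ĥ • xw = xw := by
    rw [← mk_smul, ← slToPGL_apply, ← hxw_eq]
    exact hx _ (Subgroup.mem_map_of_mem _ hg)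
  rw [hxw, he, smul_symm_mk_eq_iff ĥ hw0] at hfix
  obtain ⟨a, ha⟩ := hfix
  -- `a` is rational: compare a coordinate where `v ≠ 0`
  obtain ⟨i, hi⟩ : ∃ i, v i ≠ 0 := by
    by_contra h
    push Not at h
    exact hv0 (funext h)
  have hwi : w i ≠ 0 := fun h0 => hi (F.subtype.injective (by simpa [hw] using h0))
  have hgv : ∀ j, (((g : Matrix (Fin 2) (Fin 2) F) *ᵥ v) j : k) = a * w j := by
    intro j
    have := RingHom.map_mulVec F.subtype (g : Matrix (Fin 2) (Fin 2) F) v j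
    rw [← hĥA, ← hw, ha, Pi.smul_apply, smul_eq_mul] at this
    exact this
  have haF : a ∈ F := by
    have : a = (((g : Matrix (Fin 2) (Fin 2) F) *ᵥ v) i : k) / w i := by
      rw [hgv i, mul_div_cancel_right₀ _ hwi]
    rw [this]
    exact F.div_mem (SetLike.coe_mem _) (by simp [hw])
  refine ⟨⟨a, haF⟩, funext fun j => ?_⟩
  apply F.subtype.injective
  rw [Subfield.coe_subtype, hgv j, Pi.smul_apply]
  simp [hw]

end RationalLine

/-! ### The order of a subfield group inside `PSL₂(𝔽_Q)`: `q = Q` or `q² ≤ Q` -/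

section Arithmetic

omit [Field k] in
/-- **`q(q² - 1) ∣ Q(Q² - 1)` for powers `q = pᵃ`, `Q = pⁿ` (`a, n ≥ 1`) forces `q = Q` or
`q² ≤ Q`.**  Indeed `q ∣ Q`, say `Q = qm` with `m` a power of `p`, and `q² - 1 ∣ Q² - 1 =
m²(q² - 1) + (m² - 1)`, so `q² - 1 ∣ m² - 1`; if `m < q` this forces `m = 1`. [cite: Dickson1901, §260] -/
theorem pow_eq_pow_or_sq_le_of_mul_dvd {p a n : ℕ} (hp : p.Prime) (ha : 1 ≤ a) (hn : 1 ≤ n)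
    (h : p ^ a * ((p ^ a) ^ 2 - 1) ∣ p ^ n * ((p ^ n) ^ 2 - 1)) :
    p ^ a = p ^ n ∨ (p ^ a) ^ 2 ≤ p ^ n := by
  set q := p ^ a with hq
  set Q := p ^ n with hQ
  have hq1 : 1 < q := by rw [hq]; exact Nat.one_lt_pow (by omega) hp.one_lt
  have hQ1 : 1 < Q := by rw [hQ]; exact Nat.one_lt_pow (by omega) hp.one_lt
  -- `p` is coprime to `M - 1` whenever `p ∣ M`
  have hcop : ∀ M : ℕ, p ∣ M → 1 ≤ M → Nat.Coprime p (M - 1) := by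
    intro M hM hM1
    refine (Nat.Prime.coprime_iff_not_dvd hp).mpr fun hd => hp.one_lt.ne' (Nat.dvd_one.mp ?_)
    have := Nat.dvd_sub hM hd
    rwa [Nat.sub_sub_self hM1] at this
  have hpq : p ∣ q := by rw [hq]; exact dvd_pow_self p (by omega)
  have hpQ : p ∣ Q := by rw [hQ]; exact dvd_pow_self p (by omega)
  have hcopQ : Nat.Coprime q (Q ^ 2 - 1) := by
    rw [hq, Nat.coprime_pow_left_iff (by omega)]
    exact hcop _ (dvd_pow hpQ two_ne_zero) (Nat.one_le_pow _ _ (by omega))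
  have hcopq : Nat.Coprime p (q ^ 2 - 1) := hcop _ (dvd_pow hpq two_ne_zero) (Nat.one_le_pow _ _ (by omega))
  -- (i) `q ∣ Q`, `Q = q m` with `m` a power of `p`
  have hqQ : q ∣ Q := hcopQ.dvd_of_dvd_mul_right ((Dvd.intro _ rfl : q ∣ q * (q ^ 2 - 1)).trans h)
  obtain ⟨m, hm⟩ := hqQ
  obtain ⟨j, -, hmj⟩ := (Nat.dvd_prime_pow hp).mp (Dvd.intro_left _ hm.symm : m ∣ p ^ n)
  have hm1 : 1 ≤ m := by rw [hmj]; exact Nat.one_le_pow _ _ hp.pos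
  -- (ii) `q² - 1 ∣ Q² - 1`
  have h2 : q ^ 2 - 1 ∣ m * (Q ^ 2 - 1) := by
    have : Q * (Q ^ 2 - 1) = q * (m * (Q ^ 2 - 1)) := by rw [hm, mul_assoc]
    rw [this] at h
    exact Nat.dvd_of_mul_dvd_mul_left (by omega : 0 < q) h
  have hcopm : Nat.Coprime (q ^ 2 - 1) m := by
    rw [hmj]
    exact (hcopq.symm).pow_right j
  have h3 : q ^ 2 - 1 ∣ Q ^ 2 - 1 := hcopm.dvd_of_dvd_mul_left h2
  -- (iii) `Q² - 1 = m²(q² - 1) + (m² - 1)`, so `q² - 1 ∣ m² - 1`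
  have hq2 : 1 ≤ q ^ 2 := Nat.one_le_pow _ _ (by omega)
  have hm2 : 1 ≤ m ^ 2 := Nat.one_le_pow _ _ hm1
  have hmq2 : 1 ≤ m ^ 2 * q ^ 2 := Nat.one_le_iff_ne_zero.mpr (Nat.mul_ne_zero (by omega) (by omega))
  have hdec : Q ^ 2 - 1 = m ^ 2 * (q ^ 2 - 1) + (m ^ 2 - 1) := by
    rw [hm, mul_pow, mul_comm (q ^ 2)]
    zify [hq2, hm2, hmq2]
    ring
  have h4 : q ^ 2 - 1 ∣ m ^ 2 - 1 := by
    rw [hdec] at h3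
    exact (Nat.dvd_add_right (Dvd.intro_left _ rfl)).mp h3
  -- (iv) `m < q` forces `m = 1`; otherwise `q² ≤ qm = Q`
  by_cases hmq : m < q
  · left
    have hlt : m ^ 2 - 1 < q ^ 2 - 1 := by
      have := Nat.pow_lt_pow_left hmq two_ne_zero
      omega
    have h0 : m ^ 2 - 1 = 0 := Nat.eq_zero_of_dvd_of_lt h4 hlt
    have hm_le : m ≤ 1 := by
      by_contra hcon
      have : 2 ≤ m := by omega
      have : 4 ≤ m ^ 2 := by nlinarith
      omega
    have hm_eq : m = 1 := le_antisymm hm_le hm1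
    rw [hm, hm_eq, mul_one]
  · right
    push Not at hmq
    calc q ^ 2 = q * q := sq q
      _ ≤ q * m := Nat.mul_le_mul_left q hmq
      _ = Q := hm.symm

end Arithmetic

section SubfieldCase

/-- In characteristic `2` every unit of a finite field is a square, so `SL₂(E) → PGL₂(E)` is onto
and `PSL₂(E) = PGL₂(E)` inside `PGL₂(k)`. [cite: Dickson1901, §239] -/
theorem pslTwo_eq_pglTwo_of_two (p : ℕ) [Fact p.Prime] [CharP k p] (hp : p = 2) (E : Subfield k)
    [Finite E] : pslTwo E = pglTwo E := by
  classical
  haveI : Fintype E := Fintype.ofFinite E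
  haveI : CharP E p := inferInstance
  obtain ⟨n, -, hq⟩ := FiniteField.card E p
  -- every unit of `E` is a square
  have hR : ∀ r : (E)ˣ, ∃ c : (E)ˣ, c ^ Fintype.card (Fin 2) = r := by
    intro r
    refine ⟨r ^ (2 ^ ((n : ℕ) - 1)), ?_⟩
    rw [Fintype.card_fin, ← pow_mul, ← pow_succ, Nat.sub_add_cancel n.pos, ← hp, ← hq]
    ext
    rw [Units.val_pow_eq_pow_val, FiniteField.pow_card]
  have hsurj : Function.Surjective (Matrix.SpecialLinearGroup.toPGL : SL(2, E) →* PGL(Fin 2, E)) := by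
    intro y
    obtain ⟨X, hX⟩ := Matrix.ProjectiveSpecialLinearGroup.toPGL_surj_of_roots hR y
    induction X using QuotientGroup.induction_on with
    | H g => exact ⟨g, by rw [← hX, Matrix.ProjectiveSpecialLinearGroup.toPGL_mk]; rfl⟩
  apply le_antisymm (pslTwo_le_pglTwo E)
  rintro _ ⟨y, rfl⟩
  obtain ⟨g, rfl⟩ := hsurj y
  exact ⟨g, rfl⟩

/-- `|PSL₂(E)| = q(q² - 1)` in characteristic `2`. [cite: Dickson1901, §239] -/
theorem card_pslTwo_of_two (p : ℕ) [Fact p.Prime] [CharP k p] (hp : p = 2) (E : Subfield k) [Finite E] :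
    Nat.card (pslTwo E) = Nat.card E * (Nat.card E ^ 2 - 1) := by
  rw [pslTwo_eq_pglTwo_of_two p hp E, card_pglTwo]

/-- `|PSL₂(E)|` depends only on `|E|` (it is `q(q²-1)/gcd(2, q-1)`). [cite: Dickson1901, §239] -/
theorem card_pslTwo_eq_of_card_eq (p : ℕ) [Fact p.Prime] [CharP k p] (E F : Subfield k) [Finite E] [Finite F]
    (h : Nat.card E = Nat.card F) : Nat.card (pslTwo E) = Nat.card (pslTwo F) := by
  by_cases hp : p = 2
  · rw [card_pslTwo_of_two p hp E, card_pslTwo_of_two p hp F, h]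
  · have hE := two_mul_card_pslTwo E p hp
    have hF := two_mul_card_pslTwo F p hp
    rw [h, ← hF] at hE
    omega

/-- **A subgroup of `PSL₂(𝔽_Q)` conjugate to `PSL₂(𝔽_q)` or `PGL₂(𝔽_q)` is everything or has
`|H|² ≤ Q³`.**  For `q(q² - 1) ∣ |H| · 2 ∣ Q(Q² - 1)` forces `q = Q` (and then `|H| ≥ |PSL₂(𝔽_Q)|`)
or `q² ≤ Q` (and then `|H| ≤ q(q²-1) < Q^{3/2}`) (Dickson 1901, §260: the subgroups
`PSL₂(p^s)`, `PGL₂(p^s)` of `PSL₂(p^r)` occur for `s ∣ r`; Faber 2011, Thm. D). [cite: Dickson1901, §260] -/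
theorem eq_or_card_sq_le_of_conj_eq (p : ℕ) [Fact p.Prime] [CharP k p] (F : Subfield k) [Finite F]
    {H : Subgroup PGL(Fin 2, k)}
    [Finite H] (hH : H ≤ pslTwo F) {E : Subfield k} [Finite E] {t : PGL(Fin 2, k)}
    (ht : MulAut.conj t • H = pslTwo E ∨ MulAut.conj t • H = pglTwo E) :
    H = pslTwo F ∨ Nat.card H ^ 2 ≤ Nat.card F ^ 3 := by
  classical
  have pp : p.Prime := Fact.out
  haveI : Fintype E := Fintype.ofFinite E
  haveI : Fintype F := Fintype.ofFinite F
  haveI : CharP E p := inferInstance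
  haveI : CharP F p := inferInstance
  haveI : Finite (pslTwo F) := Finite.of_surjective _ (MonoidHom.rangeRestrict_surjective _)
  obtain ⟨a, -, hq⟩ := FiniteField.card E p
  obtain ⟨n, -, hQ⟩ := FiniteField.card F p
  rw [← Nat.card_eq_fintype_card] at hq hQ
  -- `|H| = |PSL₂(E)|` or `|PGL₂(E)|`
  have hcardH : Nat.card H = Nat.card (pslTwo E) ∨ Nat.card H = Nat.card (pglTwo E) := by
    rcases ht with h | h
    · left; rw [← h, card_conj_smul]
    · right; rw [← h, card_conj_smul]
  -- `q(q² - 1) ∣ Q(Q² - 1)`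
  have hdvdH : Nat.card H ∣ Nat.card (pslTwo F) := Subgroup.card_dvd_of_le hH
  have hdvd : Nat.card E * (Nat.card E ^ 2 - 1) ∣ Nat.card F * (Nat.card F ^ 2 - 1) := by
    rcases hcardH with h | h
    · by_cases hp2 : p = 2
      · rw [← card_pslTwo_of_two p hp2 E, ← h]
        exact hdvdH.trans (card_pslTwo_dvd F)
      · rw [← two_mul_card_pslTwo E p hp2, ← two_mul_card_pslTwo F p hp2, ← h]
        exact Nat.mul_dvd_mul_left 2 hdvdH
    · rw [← card_pglTwo, ← h]
      exact hdvdH.trans (card_pslTwo_dvd F)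
  have hle : Nat.card H ≤ Nat.card E * (Nat.card E ^ 2 - 1) := by
    rcases hcardH with h | h
    · rw [h]; exact card_pslTwo_le E
    · rw [h, card_pglTwo]
  rw [hq, hQ] at hdvd
  rcases pow_eq_pow_or_sq_le_of_mul_dvd pp a.pos n.pos hdvd with heq | hsq
  · -- `q = Q`: `|H| ≥ |PSL₂(F)|`, so `H = PSL₂(F)`
    left
    have hEF : Nat.card E = Nat.card F := by rw [hq, hQ, heq]
    refine Subgroup.eq_of_le_of_card_ge hH ?_
    rcases hcardH with h | h
    · rw [h, card_pslTwo_eq_of_card_eq p E F hEF]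
    · rw [h, card_pglTwo, hEF]; exact card_pslTwo_le F
  · -- `q² ≤ Q`: `|H|² ≤ (q(q²-1))² ≤ q⁶ ≤ Q³`
    right
    rw [← hq, ← hQ] at hsq
    have h1 : Nat.card H ≤ Nat.card E ^ 3 :=
      hle.trans (by
        calc Nat.card E * (Nat.card E ^ 2 - 1) ≤ Nat.card E * Nat.card E ^ 2 :=
              Nat.mul_le_mul_left _ (Nat.sub_le _ _)
          _ = Nat.card E ^ 3 := by ring)
    calc Nat.card H ^ 2 ≤ (Nat.card E ^ 3) ^ 2 := Nat.pow_le_pow_left h1 2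
      _ = (Nat.card E ^ 2) ^ 3 := by ring
      _ ≤ Nat.card F ^ 3 := Nat.pow_le_pow_left hsq 3

end SubfieldCase

/-! ### Assembly for `p ≥ 5`: large proper subgroups of `SL₂(𝔽_q)` fix a line -/

section FiveLe

variable [DecidableEq k] (p : ℕ) [Fact p.Prime] [CharP k p]

/-- **Dickson's theorem for `SL₂(𝔽_q)`, large-subgroup form, `p ≥ 5`** (embedded version: `F`
a finite subfield of an algebraically closed field `k` of characteristic `p ≥ 5`).  A proper
subgroup `L < SL₂(F)` with no common eigenvector in `F²` satisfies
`|L| ≤ 4(q + 1)` or `|L| ≤ 120` or `|L|² ≤ 4q³` (`q = |F|`): by Dickson's classification of the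
image `H` of `L` in `PGL₂(k̄)` (parts I–VI; Faber 2011, Thm. B; Dickson 1901, Ch. XII, §260) —
`H` `p`-regular (cyclic of order `∣ q ∓ 1`, dihedral, `𝔄₄`, `𝔖₄`, `𝔄₅`: `|H| ≤ 2(q+1)` or `≤ 60`),
or `H` fixes a point (then an `F`-rational one: excluded), or `H ≅ PSL₂/PGL₂(𝔽_{q'})` with
`q' = q` (then `L = SL₂(F)`: excluded) or `q'² ≤ q`. [cite: Faber2011, Thm. B, Thm. D] -/
theorem card_le_or_of_forall_exists_ne_smul_of_five_le [IsAlgClosed k] (hp5 : 5 ≤ p)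
    (F : Subfield k) [Finite F] (L : Subgroup SL(2, F)) (hL : L ≠ ⊤)
    (hfix : ¬ ∃ v : Fin 2 → F, v ≠ 0 ∧ ∀ g ∈ L, ∃ a : F, (g : Matrix (Fin 2) (Fin 2) F) *ᵥ v = a • v) :
    Nat.card L ≤ 4 * (Nat.card F + 1) ∨ Nat.card L ≤ 120 ∨ Nat.card L ^ 2 ≤ 4 * Nat.card F ^ 3 := by
  classical
  have pp : p.Prime := Fact.out
  haveI : Fintype F := Fintype.ofFinite F
  haveI : CharP F p := inferInstance
  obtain ⟨n, -, hQ⟩ := FiniteField.card F p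
  rw [← Nat.card_eq_fintype_card] at hQ
  have hF3 : 3 < Nat.card F := by
    rw [hQ]
    calc 3 < p := by omega
      _ = p ^ 1 := (pow_one p).symm
      _ ≤ p ^ (n : ℕ) := Nat.pow_le_pow_right pp.pos n.pos
  haveI : Finite L := inferInstance
  haveI : Finite (L.map (slToPGL F)) := Finite.of_surjective
    (fun x : L => (⟨slToPGL F x, Subgroup.mem_map_of_mem _ x.2⟩ : L.map (slToPGL F)))
    (by rintro ⟨y, hy⟩; obtain ⟨x, hx, rfl⟩ := Subgroup.mem_map.mp hy; exact ⟨⟨x, hx⟩, rfl⟩)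
  have hcardL := card_le_two_mul_card_map F L
  have hHle : L.map (slToPGL F) ≤ pslTwo F := by
    rw [← range_slToPGL]; exact Subgroup.map_le_range _ _
  by_cases hdvd : p ∣ Nat.card (L.map (slToPGL F))
  · rcases exists_smul_eq_or_exists_conj_eq_of_five_le p hp5 (L.map (slToPGL F)) hdvd with
      ⟨x, hx⟩ | ⟨E, t, hE, ht⟩
    · exact absurd (exists_mulVec_eq_smul_of_forall_smul_eq p F L hdvd hx) hfix
    · haveI := hE
      rcases eq_or_card_sq_le_of_conj_eq p F hHle ht with heq | hsq
      · exact absurd (eq_top_of_map_slToPGL_eq F hF3 heq) hL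
      · right; right
        calc Nat.card L ^ 2 ≤ (2 * Nat.card (L.map (slToPGL F))) ^ 2 := Nat.pow_le_pow_left hcardL 2
          _ = 4 * Nat.card (L.map (slToPGL F)) ^ 2 := by ring
          _ ≤ 4 * Nat.card F ^ 3 := Nat.mul_le_mul_left 4 hsq
  · rcases card_le_or_of_le_pglTwo_of_not_dvd p F (L.map (slToPGL F))
      (hHle.trans (pslTwo_le_pglTwo F)) hdvd with h | h
    · left; omega
    · right; left; omega

end FiveLe

end Literature.GroupTheory.SpecificGroups.PGL2

/-! ### Transport to an abstract finite field -/

namespace Literature.GroupTheory.SpecificGroups.SL2Dickson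

open Literature.GroupTheory.SpecificGroups.PGL2

section Transport

variable {F₀ F : Type*} [Field F₀] [Field F] (e : F₀ ≃+* F)

/-- `SL₂(e)` is injective for a ring isomorphism (indeed for any injective `e`). [folklore] -/
private theorem specialLinearGroup_map_injective :
    Function.Injective (Matrix.SpecialLinearGroup.map (n := Fin 2) (e : F₀ →+* F)) := by
  intro x y h
  apply Subtype.ext
  exact Matrix.map_injective e.injective (congrArg Subtype.val h)

/-- `SL₂(e)` is surjective for a ring isomorphism `e`. [folklore] -/
private theorem specialLinearGroup_map_surjective :
    Function.Surjective (Matrix.SpecialLinearGroup.map (n := Fin 2) (e : F₀ →+* F)) := by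
  intro g
  refine ⟨Matrix.SpecialLinearGroup.map (n := Fin 2) (e.symm : F →+* F₀) g, Subtype.ext ?_⟩
  change ((g : Matrix (Fin 2) (Fin 2) F).map e.symm).map e = g
  rw [Matrix.map_map]
  convert Matrix.map_id _
  funext x
  exact e.apply_symm_apply x

/-- Transport of "proper subgroup" along `SL₂(e)`. [folklore] -/
private theorem map_ne_top_of_ne_top {L : Subgroup SL(2, F₀)} (hL : L ≠ ⊤) :
    L.map (Matrix.SpecialLinearGroup.map (n := Fin 2) (e : F₀ →+* F)) ≠ ⊤ := by
  intro htop
  apply hL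
  rw [eq_top_iff]
  intro g _
  have hg : Matrix.SpecialLinearGroup.map (n := Fin 2) (e : F₀ →+* F) g ∈
      L.map (Matrix.SpecialLinearGroup.map (n := Fin 2) (e : F₀ →+* F)) := by
    rw [htop]; exact Subgroup.mem_top _
  obtain ⟨g', hg', hgg'⟩ := Subgroup.mem_map.mp hg
  rw [← specialLinearGroup_map_injective e hgg']
  exact hg'

/-- Transport of a common eigenvector back along `SL₂(e)`. [folklore] -/
private theorem exists_eigenvector_of_map {L : Subgroup SL(2, F₀)}
    (h : ∃ v : Fin 2 → F, v ≠ 0 ∧ ∀ g ∈ L.map (Matrix.SpecialLinearGroup.map (n := Fin 2) (e : F₀ →+* F)),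
      ∃ a : F, (g : Matrix (Fin 2) (Fin 2) F) *ᵥ v = a • v) :
    ∃ v : Fin 2 → F₀, v ≠ 0 ∧ ∀ g ∈ L, ∃ a : F₀, (g : Matrix (Fin 2) (Fin 2) F₀) *ᵥ v = a • v := by
  obtain ⟨v, hv0, hv⟩ := h
  refine ⟨e.symm ∘ v, ?_, ?_⟩
  · intro h0
    apply hv0
    funext i
    have := congrFun h0 i
    simpa using this
  · intro g hg
    obtain ⟨a, ha⟩ := hv _ (Subgroup.mem_map_of_mem _ hg)
    refine ⟨e.symm a, funext fun i => ?_⟩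
    have h1 := RingHom.map_mulVec (e.symm : F →+* F₀)
      ((g : Matrix (Fin 2) (Fin 2) F₀).map (e : F₀ →+* F)) v i
    have h2 : ((g : Matrix (Fin 2) (Fin 2) F₀).map (e : F₀ →+* F)).map (e.symm : F →+* F₀) =
        (g : Matrix (Fin 2) (Fin 2) F₀) := by
      rw [Matrix.map_map]
      convert Matrix.map_id _
      funext x
      exact e.symm_apply_apply x
    rw [h2] at h1
    have ha' : ((g : Matrix (Fin 2) (Fin 2) F₀).map (e : F₀ →+* F)) *ᵥ v = a • v := ha
    rw [ha'] at h1
    have h1' : (e.symm : F →+* F₀) ((a • v) i) =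
        ((g : Matrix (Fin 2) (Fin 2) F₀) *ᵥ (⇑e.symm ∘ v)) i := h1
    rw [← h1']
    simp

end Transport

section FiveLe

/-- **Dickson's theorem for `SL₂(𝔽_q)`, large-subgroup form, `p ≥ 5`** (abstract finite field
`F` of characteristic `p ≥ 5`, `q = |F|`): a proper subgroup `L < SL₂(F)` without a common
eigenvector in `F²` has `|L| ≤ 4(q + 1)`, or `|L| ≤ 120`, or `|L|² ≤ 4q³`.  From the embedded
version `PGL2.card_le_or_of_forall_exists_ne_smul_of_five_le` through `F ≅ 𝔽_q ≤ 𝔽̄_q`.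
[cite: Faber2011, Thm. B, Thm. D] -/
theorem card_le_or_of_forall_exists_ne_smul_of_five_le (F : Type*) [Field F] [Fintype F]
    (p : ℕ) [Fact p.Prime] [CharP F p] (hp5 : 5 ≤ p) (L : Subgroup SL(2, F)) (hL : L ≠ ⊤)
    (hfix : ¬ ∃ v : Fin 2 → F, v ≠ 0 ∧ ∀ g ∈ L, ∃ a : F, (g : Matrix (Fin 2) (Fin 2) F) *ᵥ v = a • v) :
    Nat.card L ≤ 4 * (Fintype.card F + 1) ∨ Nat.card L ≤ 120 ∨
      Nat.card L ^ 2 ≤ 4 * Fintype.card F ^ 3 := by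
  classical
  set k := AlgebraicClosure F with hk
  set f := algebraMap F k with hf
  set E : Subfield k := f.fieldRange with hE
  set e : F ≃+* E := RingHom.rangeRestrictFieldEquiv f with he
  haveI : Finite E := Finite.of_equiv F e.toEquiv
  have hcardE : Nat.card E = Fintype.card F := by
    rw [← Nat.card_eq_fintype_card, Nat.card_congr e.toEquiv]
  set φ := Matrix.SpecialLinearGroup.map (n := Fin 2) (e : F →+* E) with hφ
  have hinj := specialLinearGroup_map_injective e
  have h := PGL2.card_le_or_of_forall_exists_ne_smul_of_five_le p hp5 E (L.map φ)
    (map_ne_top_of_ne_top e hL) (fun h => hfix (exists_eigenvector_of_map e h))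
  rw [Subgroup.card_map_of_injective hinj, hcardE] at h
  exact h

/-- **Large proper subgroups of `SL₂(𝔽_q)` fix a line** (`p ≥ 5`): for every `β > 0` there is
`Q₀` such that for every finite field `F` of characteristic `p ≥ 5` with `|F| ≥ Q₀`, every proper
subgroup `L < SL₂(F)` with `|L| ≥ β|F|²` has a common eigenvector `v ∈ F² ∖ 0` (i.e. lies in a
Borel subgroup) — Dickson's classification: the other subgroups have order `O(|F|)`, `≤ 120`, or
`O(|F|^{3/2})`. [cite: Faber2011, Thm. D; Dickson1901, §260] -/
theorem exists_forall_exists_eigenvector_of_five_le (β : ℝ) (hβ : 0 < β) :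
    ∃ Q₀ : ℕ, ∀ (F : Type*) [Field F] [Fintype F] (p : ℕ) [Fact p.Prime] [CharP F p], 5 ≤ p →
      Q₀ ≤ Fintype.card F → ∀ L : Subgroup SL(2, F), L ≠ ⊤ →
        β * (Fintype.card F : ℝ) ^ 2 ≤ Nat.card L →
          ∃ v : Fin 2 → F, v ≠ 0 ∧ ∀ g ∈ L, ∃ a : F, (g : Matrix (Fin 2) (Fin 2) F) *ᵥ v = a • v := by
  refine ⟨⌈8 / β⌉₊ + ⌈120 / β⌉₊ + ⌈4 / β ^ 2⌉₊ + 1, ?_⟩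
  intro F _ _ p _ _ hp5 hQ L hL hβL
  by_contra hfix
  set Q := Fintype.card F with hQdef
  have hQ1 : (1 : ℝ) ≤ Q := by exact_mod_cast Fintype.card_pos
  have hQr : (⌈8 / β⌉₊ : ℝ) + ⌈120 / β⌉₊ + ⌈4 / β ^ 2⌉₊ + 1 ≤ Q := by exact_mod_cast hQ
  have h8 : 8 < β * Q := by
    have : 8 / β < (Q : ℝ) := by linarith [Nat.le_ceil (8 / β), Nat.le_ceil (120 / β), Nat.le_ceil (4 / β ^ 2)]
    rwa [div_lt_iff₀ hβ, mul_comm] at this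
  have h120 : 120 < β * Q := by
    have : 120 / β < (Q : ℝ) := by linarith [Nat.le_ceil (8 / β), Nat.le_ceil (120 / β), Nat.le_ceil (4 / β ^ 2)]
    rwa [div_lt_iff₀ hβ, mul_comm] at this
  have h4 : 4 < β ^ 2 * Q := by
    have : 4 / β ^ 2 < (Q : ℝ) := by linarith [Nat.le_ceil (8 / β), Nat.le_ceil (120 / β), Nat.le_ceil (4 / β ^ 2)]
    rwa [div_lt_iff₀ (by positivity), mul_comm] at this
  rcases card_le_or_of_forall_exists_ne_smul_of_five_le F p hp5 L hL hfix with h | h | h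
  · have h' : (Nat.card L : ℝ) ≤ 4 * (Q + 1) := by exact_mod_cast h
    nlinarith
  · have h' : (Nat.card L : ℝ) ≤ 120 := by exact_mod_cast h
    nlinarith
  · have h' : (Nat.card L : ℝ) ^ 2 ≤ 4 * Q ^ 3 := by exact_mod_cast h
    have h1 : β ^ 2 * (Q : ℝ) ^ 4 ≤ (Nat.card L : ℝ) ^ 2 := by
      have h0 : 0 ≤ β * (Q : ℝ) ^ 2 := by positivity
      nlinarith
    have hQ3 : 0 < (Q : ℝ) ^ 3 := by positivity
    have h2 : 4 * (Q : ℝ) ^ 3 < β ^ 2 * Q ^ 4 := by nlinarith [mul_pos (sub_pos.mpr h4) hQ3]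
    linarith

end FiveLe

end Literature.GroupTheory.SpecificGroups.SL2Dickson
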